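import Summits.AtomisticToContinuum.Crystallization.Theorems.OverbindingBudgetEnergyLayerTail

/-!
# OverbindingBudget — part XXII-L: the TAIL leaf PROVED — `LayerFieldTailSum (17/16) (3/8) (23/20) s₀ (53/s₀³)` (decomp-a2c lens-4, g34)

From part XXII-K's per-span bound (`layerField_bounds`, smear parameter `ε = 1`, cell radius `R_c = 17/16`):

* §1 the Gram determinant of an admissible cell (`‖a‖, ‖b‖ ≤ 17/16`, lattice vectors `≥ 9/10`) is `≥ 9/20`;
* §2 a span at height `P ≥ 15/8` has summable field family, `layerField a b v ≥ −(22/7) P⁻⁴` and `|layerField a b v| ≤ 5 P⁻⁴`;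
* §3 `Σ_{i ≥ 0} (i + s₀ + 1)⁻⁴ ≤ 1/(3 s₀³)` (telescoping);
* §4 ★ `layerFieldTailSum_holds : 4 ≤ s₀ → LayerFieldTailSum (17/16) (3/8) (23/20) s₀ (53/s₀³)` — the TAIL leaf of cut XXXI is a
  THEOREM for every `s₀ ≥ 4` (`53/s₀³`: `= 4.1·10⁻⁵` at `s₀ = 109`, `= 10⁻⁵` at `s₀ = 175`);
* §5 cone XXXII `rdef_thirtysecond_of_recordK_finCert_ref` = cone XXXI with TAIL discharged: beneath ★ only STR [ANALYTIC·M] and the two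
  FINITE certificates FIN-T / FIN-S at level `e⋆ + 2κ' + 53/s₀³` remain (`s₀` symbolic, chosen by the census).

Sorry-free, standard axioms; no instances / notation declared.
-/

noncomputable section

namespace Summit.AtomisticToContinuum.Crystallization.Theorems.OverbindingBudgetEnergyLayerTailSum

open Real Finset
open scoped RealInnerProductSpace
open Literature.MathematicalPhysics.StatisticalMechanics (lennardJones groundStateEnergy)
open Summit.AtomisticToContinuum.Crystallization.Theses.OverbindingBudget (RobustDefectLimitWindows)
open Summit.AtomisticToContinuum.Crystallization.Theses.PricedLinkCensus (ChargedEnergyGap)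
open Summit.AtomisticToContinuum.Crystallization.Theorems.ChargedEnergyGapNegative (eStar)
open Summit.AtomisticToContinuum.Crystallization.Theorems.OverbindingBudgetGradedBareness (CleanlessExcessT)
open Summit.AtomisticToContinuum.Crystallization.Theorems.OverbindingBudgetCoherentCut (CoherentResidual)
open Summit.AtomisticToContinuum.Crystallization.Theorems.OverbindingBudgetUniformCutStatements (GrossCleanBallsU)
open Summit.AtomisticToContinuum.Crystallization.Theorems.OverbindingBudgetElasticSplitScale (CompressedVirialLaw)
open Summit.AtomisticToContinuum.Crystallization.Theorems.OverbindingBudgetElasticSplitShear (StressFree)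
open Summit.AtomisticToContinuum.Crystallization.Theorems.ChartedPlanarOrderChunkFloor (E3)
open Summit.AtomisticToContinuum.Crystallization.Theorems.ChartedPlanarOrderRigidityDoor (IsNash)
open Summit.AtomisticToContinuum.Crystallization.Theorems.ChartedPlanarOrderDensityDichotomy (μS IsSep)
open Summit.AtomisticToContinuum.Crystallization.Theorems.ChartedPlanarOrderDoorLayered (Layered)
open Summit.AtomisticToContinuum.Crystallization.Theorems.ChartedPlanarOrderProfileSlavingLJ (IsStacked gapStress incr)
open Summit.AtomisticToContinuum.Crystallization.Theorems.OverbindingBudgetScaleWidening (IsCleanW DoorPeriodicW)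
open Summit.AtomisticToContinuum.Crystallization.Theorems.OverbindingBudgetTwoShellShape (TwoShellShape BarlowGluingW)
open Summit.AtomisticToContinuum.Crystallization.Theorems.OverbindingBudgetStackedRigidityW (StackedReductionW GapStressVanishesW)
open Summit.AtomisticToContinuum.Crystallization.Theorems.OverbindingBudgetRegistryCut (IsUnitNormal Pinned RegistryLocalisationW RegistryResidual
  RegistryTube RegistryZeroExists zeroExists_of_residual_tube)
open Summit.AtomisticToContinuum.Crystallization.Theorems.OverbindingBudgetRegistrySquare (PinnedSq)
open Summit.AtomisticToContinuum.Crystallization.Theorems.OverbindingBudgetRegistryDichotomy (IsTType IsSType RegistryGeometryW BalancedLocus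
  registryLocalisationW_of_geometry_locus sqRegistryLocalisationW_of_geometry_height)
open Summit.AtomisticToContinuum.Crystallization.Theorems.OverbindingBudgetRegistryDichotomyCW (RegistryMetricCW)
open Summit.AtomisticToContinuum.Crystallization.Theorems.OverbindingBudgetEnergyPinning (StackedCellPinningU)
open Summit.AtomisticToContinuum.Crystallization.Theorems.OverbindingBudgetEnergyStraightening (layerField StraightBound StraightenedFloor
  StraightCellEnergyT StraightCellEnergyS)
open Summit.AtomisticToContinuum.Crystallization.Theorems.OverbindingBudgetEnergySquareExtinction (SquareCellsExtinct stackedCellPinningU_of_sqExtinct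
  sqRegistryGeometryW_empty sqBalancedHeight_empty sqRegistryMetricCW_empty)
open Summit.AtomisticToContinuum.Crystallization.Theorems.OverbindingBudgetEnergyTubeBox (RegistryPinningP TubeConvexRefP
  rdef_of_grossU_shape_gluing_pinningU_convexRefP_registry)
open Summit.AtomisticToContinuum.Crystallization.Theorems.OverbindingBudgetEnergyFinCert (StraightCellEnergyFinT SquareCellsExtinctFin
  LayerFieldTailSum stackedCellPinningU_of_finCert)
open Summit.AtomisticToContinuum.Crystallization.Theorems.OverbindingBudgetEnergyLayerTail (layerField_bounds)

/-! ## §1 The Gram determinant of an admissible cell -/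

/-- `G = ‖a‖²‖b‖² − ⟪a,b⟫² ≥ 9/20` for a cell with `‖a‖, ‖b‖ ≤ 17/16` all of whose non-zero lattice vectors are `≥ 9/10`
(uses only `a`, `b`, `a + b`, `a − b`). -/
theorem gram_ge_of_cell {a b : E3} (hab : LinearIndependent ℝ ![a, b]) (ha : ‖a‖ ≤ 17 / 16) (hb : ‖b‖ ≤ 17 / 16)
    (hlat : ∀ i j : ℤ, ((i : ℝ) • a + (j : ℝ) • b) ≠ 0 → 9 / 10 ≤ ‖(i : ℝ) • a + (j : ℝ) • b‖) :
    9 / 20 ≤ ‖a‖ ^ 2 * ‖b‖ ^ 2 - ⟪a, b⟫ ^ 2 := by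
  have hli := LinearIndependent.pair_iff.1 hab
  have hnz : ∀ i j : ℤ, ¬ (i = 0 ∧ j = 0) → ((i : ℝ) • a + (j : ℝ) • b) ≠ 0 := by
    intro i j hij h0
    obtain ⟨hi, hj⟩ := hli (i : ℝ) (j : ℝ) h0
    exact hij ⟨by exact_mod_cast hi, by exact_mod_cast hj⟩
  have h10 := hlat 1 0 (hnz 1 0 (by norm_num))
  have h01 := hlat 0 1 (hnz 0 1 (by norm_num))
  have h11 := hlat 1 1 (hnz 1 1 (by norm_num))
  have h1m := hlat 1 (-1) (hnz 1 (-1) (by norm_num))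
  simp only [Int.cast_one, Int.cast_zero, Int.cast_neg, one_smul, zero_smul, add_zero, zero_add, neg_smul] at h10 h01 h11 h1m
  have hpa : (9 / 10 : ℝ) ^ 2 ≤ ‖a‖ ^ 2 := pow_le_pow_left₀ (by norm_num) h10 2
  have hpb : (9 / 10 : ℝ) ^ 2 ≤ ‖b‖ ^ 2 := pow_le_pow_left₀ (by norm_num) h01 2
  have hqa : ‖a‖ ^ 2 ≤ (17 / 16 : ℝ) ^ 2 := pow_le_pow_left₀ (norm_nonneg _) ha 2
  have hqb : ‖b‖ ^ 2 ≤ (17 / 16 : ℝ) ^ 2 := pow_le_pow_left₀ (norm_nonneg _) hb 2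
  have hs : (9 / 10 : ℝ) ^ 2 ≤ ‖a + b‖ ^ 2 := pow_le_pow_left₀ (by norm_num) h11 2
  have hd : (9 / 10 : ℝ) ^ 2 ≤ ‖a + -b‖ ^ 2 := pow_le_pow_left₀ (by norm_num) h1m 2
  rw [norm_add_sq_real] at hs hd
  rw [inner_neg_right, norm_neg] at hd
  have hB : ⟪a, b⟫ ^ 2 ≤ ((‖a‖ ^ 2 + ‖b‖ ^ 2 - 81 / 100) / 2) ^ 2 := by
    apply sq_le_sq' <;> nlinarith
  have hxy : (‖a‖ ^ 2 - ‖b‖ ^ 2) ^ 2 ≤ (289 / 256 - 81 / 100 : ℝ) ^ 2 := by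
    apply sq_le_sq' <;> nlinarith
  nlinarith [hB, hxy, hpa, hpb]

/-! ## §2 A span at height `≥ 15/8` -/

/-- the half-cell radius of an admissible cell is `≤ 17/16`. -/
theorem cellRadius_le {a b : E3} (ha : ‖a‖ ≤ 17 / 16) (hb : ‖b‖ ≤ 17 / 16) (ζ₁ ζ₂ : ℝ) (h1 : |ζ₁| ≤ 1 / 2) (h2 : |ζ₂| ≤ 1 / 2) :
    ‖ζ₁ • a + ζ₂ • b‖ ≤ 17 / 16 := by
  calc ‖ζ₁ • a + ζ₂ • b‖ ≤ ‖ζ₁ • a‖ + ‖ζ₂ • b‖ := norm_add_le _ _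
    _ = |ζ₁| * ‖a‖ + |ζ₂| * ‖b‖ := by rw [norm_smul, norm_smul, Real.norm_eq_abs, Real.norm_eq_abs]
    _ ≤ 1 / 2 * (17 / 16) + 1 / 2 * (17 / 16) :=
        add_le_add (mul_le_mul h1 ha (norm_nonneg _) (by norm_num)) (mul_le_mul h2 hb (norm_nonneg _) (by norm_num))
    _ = 17 / 16 := by norm_num

/-- ★ a span at height `P = ⟪v, n⟫ ≥ 15/8` over an admissible cell: summable field family, `layerField a b v ≥ −(22/7) P⁻⁴`,
`|layerField a b v| ≤ 5 P⁻⁴` (part K's bound with `ε = 1`, `R_c = 17/16`, `T₂ ≥ P²`, `√G ≥ 67/100`, `π < 3.15`). -/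
theorem layerField_far {a b n v : E3} (hab : LinearIndependent ℝ ![a, b]) (hn : IsUnitNormal a b n) (ha : ‖a‖ ≤ 17 / 16)
    (hb : ‖b‖ ≤ 17 / 16) (hG : 9 / 20 ≤ ‖a‖ ^ 2 * ‖b‖ ^ 2 - ⟪a, b⟫ ^ 2) {P : ℝ} (hP : ⟪v, n⟫ = P) (hP0 : 15 / 8 ≤ P) :
    Summable (fun ij : ℤ × ℤ => lennardJones ‖v + (((ij.1 : ℤ) : ℝ) • a + ((ij.2 : ℤ) : ℝ) • b)‖) ∧
      -(22 / 7 * (P ^ 4)⁻¹) ≤ layerField a b v ∧ |layerField a b v| ≤ 5 * (P ^ 4)⁻¹ := by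
  have hP2 : 225 / 64 ≤ P ^ 2 := by nlinarith
  have hT : 0 < (1 + 1) * ⟪v, n⟫ ^ 2 - (1 + 1⁻¹) * (17 / 16 : ℝ) ^ 2 := by rw [hP]; norm_num; nlinarith
  have hP1 : 1 ≤ ⟪v, n⟫ ^ 2 := by rw [hP]; linarith
  obtain ⟨hS, hlo, habs⟩ := layerField_bounds hab hn one_pos (cellRadius_le ha hb) hT hP1
  rw [hP] at hlo habs
  set T2 := (1 + 1) * P ^ 2 - (1 + 1⁻¹) * (17 / 16 : ℝ) ^ 2 with hT2
  have hT2ge : P ^ 2 ≤ T2 := by rw [hT2]; norm_num; nlinarith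
  have hP4 : P ^ 4 ≤ T2 ^ 2 := by
    rw [show P ^ 4 = (P ^ 2) ^ 2 by ring]; exact pow_le_pow_left₀ (by positivity) hT2ge 2
  have h67 : (67 / 100 : ℝ) ≤ Real.sqrt (‖a‖ ^ 2 * ‖b‖ ^ 2 - ⟪a, b⟫ ^ 2) := by
    rw [Real.le_sqrt' (by norm_num)]; nlinarith
  have hπ : π ≤ 3.15 := Real.pi_lt_d2.le
  have hPpos : 0 < P ^ 4 := by positivity
  have hX : π / (2 * Real.sqrt (‖a‖ ^ 2 * ‖b‖ ^ 2 - ⟪a, b⟫ ^ 2) * T2 ^ 2) ≤ 3.15 / (2 * (67 / 100) * P ^ 4) := by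
    calc π / (2 * Real.sqrt (‖a‖ ^ 2 * ‖b‖ ^ 2 - ⟪a, b⟫ ^ 2) * T2 ^ 2)
        ≤ 3.15 / (2 * Real.sqrt (‖a‖ ^ 2 * ‖b‖ ^ 2 - ⟪a, b⟫ ^ 2) * T2 ^ 2) := by gcongr
      _ ≤ 3.15 / (2 * (67 / 100) * P ^ 4) := by gcongr
  have e : (3.15 : ℝ) / (2 * (67 / 100) * P ^ 4) = 315 / 134 * (P ^ 4)⁻¹ := by
    field_simp; ring
  rw [e] at hX
  have hq : 0 < (P ^ 4)⁻¹ := by positivity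
  refine ⟨hS, ?_, ?_⟩
  · have h8 : (1 : ℝ) / 6 * ((1 + 1) ^ 3 * (π / (2 * Real.sqrt (‖a‖ ^ 2 * ‖b‖ ^ 2 - ⟪a, b⟫ ^ 2) * T2 ^ 2))) ≤ 22 / 7 * (P ^ 4)⁻¹ := by
      nlinarith
    linarith
  · have h8 : (1 : ℝ) / 4 * ((1 + 1) ^ 3 * (π / (2 * Real.sqrt (‖a‖ ^ 2 * ‖b‖ ^ 2 - ⟪a, b⟫ ^ 2) * T2 ^ 2))) ≤ 5 * (P ^ 4)⁻¹ := by
      nlinarith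
    linarith

/-! ## §3 The series `Σ (i + s₀ + 1)⁻⁴ ≤ 1/(3 s₀³)` -/

/-- the telescoping step `(u+1)⁻⁴ ≤ (3u³)⁻¹ − (3(u+1)³)⁻¹` for `u ≥ 1`. -/
theorem inv_pow_four_le_telescope {u : ℝ} (hu : 1 ≤ u) : ((u + 1) ^ 4)⁻¹ ≤ (3 * u ^ 3)⁻¹ - (3 * (u + 1) ^ 3)⁻¹ := by
  rw [← sub_nonneg]
  have hu0 : 0 < u := by linarith
  have e : (3 * u ^ 3)⁻¹ - (3 * (u + 1) ^ 3)⁻¹ - ((u + 1) ^ 4)⁻¹ = (6 * u ^ 2 + 4 * u + 1) / (3 * u ^ 3 * (u + 1) ^ 4) := by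
    field_simp; ring
  rw [e]; positivity

/-- partial sums: `Σ_{i<N} (i + s₀ + 1)⁻⁴ ≤ (3 s₀³)⁻¹ − (3 (N + s₀)³)⁻¹`. -/
theorem sum_range_inv_pow_four_le {s₀ : ℝ} (hs₀ : 1 ≤ s₀) (N : ℕ) :
    ∑ i ∈ range N, (((i : ℝ) + s₀ + 1) ^ 4)⁻¹ ≤ (3 * s₀ ^ 3)⁻¹ - (3 * ((N : ℝ) + s₀) ^ 3)⁻¹ := by
  induction N with
  | zero => simp
  | succ N ih =>
    rw [sum_range_succ]
    have h := inv_pow_four_le_telescope (u := (N : ℝ) + s₀) (by linarith [N.cast_nonneg (α := ℝ)])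
    push_cast
    have e : (N : ℝ) + 1 + s₀ = (N : ℝ) + s₀ + 1 := by ring
    rw [e]
    linarith

/-- the series: summable, with sum `≤ (3 s₀³)⁻¹`. -/
theorem tsum_inv_pow_four_le {s₀ : ℝ} (hs₀ : 1 ≤ s₀) :
    Summable (fun i : ℕ => (((i : ℝ) + s₀ + 1) ^ 4)⁻¹) ∧ ∑' i : ℕ, (((i : ℝ) + s₀ + 1) ^ 4)⁻¹ ≤ (3 * s₀ ^ 3)⁻¹ := by
  have hs : 0 < s₀ := by linarith
  have hpart : ∀ N : ℕ, ∑ i ∈ range N, (((i : ℝ) + s₀ + 1) ^ 4)⁻¹ ≤ (3 * s₀ ^ 3)⁻¹ := fun N =>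
    (sum_range_inv_pow_four_le hs₀ N).trans (sub_le_self _ (by positivity))
  exact ⟨summable_of_sum_range_le (fun _ => by positivity) hpart, Real.tsum_le_of_sum_range_le (fun _ => by positivity) hpart⟩

/-! ## §4 ★ The TAIL leaf proved -/

/-- ★★★ TAIL PROVED: `LayerFieldTailSum (17/16) (3/8) (23/20) s₀ (53/s₀³)` for every `s₀ ≥ 4` — the layer fields of an admissible
stacked family are summable and the spans `≥ s₀` contribute `≥ −53/s₀³` (per span `≥ −(22/7)((s+1)h)⁻⁴`, `h ≥ 3/8`, telescoping). -/
theorem layerFieldTailSum_holds (s₀ : ℕ) (hs₀ : 4 ≤ s₀) : LayerFieldTailSum (17 / 16) (3 / 8) (23 / 20) s₀ (53 / (s₀ : ℝ) ^ 3) := by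
  intro a b n hab ha hb hlat hn h hη₁ hη₂ v hv
  have hG := gram_ge_of_cell hab ha hb hlat
  have hs₀' : (4 : ℝ) ≤ s₀ := by exact_mod_cast hs₀
  have hs₁ : (1 : ℝ) ≤ s₀ := by linarith
  have hh : 0 < h := by linarith
  -- the shifted heights
  have hPs : ∀ s : ℕ, ⟪v (s + s₀), n⟫ = ((s : ℝ) + s₀ + 1) * h := by
    intro s; rw [hv (s + s₀)]; push_cast; ring
  have hP0 : ∀ s : ℕ, 15 / 8 ≤ ((s : ℝ) + s₀ + 1) * h := by
    intro s
    have : (5 : ℝ) ≤ (s : ℝ) + s₀ + 1 := by linarith [s.cast_nonneg (α := ℝ)]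
    nlinarith
  have hspan := fun s : ℕ => layerField_far hab hn ha hb hG (hPs s) (hP0 s)
  -- the comparison series
  obtain ⟨hf, hfle⟩ := tsum_inv_pow_four_le hs₁
  have hh4 : (h ^ 4)⁻¹ ≤ 4096 / 81 := by
    have h38 : (3 / 8 : ℝ) ^ 4 ≤ h ^ 4 := pow_le_pow_left₀ (by norm_num) hη₁ 4
    exact (inv_anti₀ (by positivity) h38).trans_eq (by norm_num)
  have hh4pos : 0 < (h ^ 4)⁻¹ := by positivity
  have epow : ∀ s : ℕ, ((((s : ℝ) + s₀ + 1) * h) ^ 4)⁻¹ = (h ^ 4)⁻¹ * ((((s : ℝ) + s₀ + 1)) ^ 4)⁻¹ := by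
    intro s; rw [mul_pow, mul_inv]; ring
  -- (i) summability of the whole family of layer fields
  have hshift : Summable (fun s : ℕ => layerField a b (v (s + s₀))) := by
    refine Summable.of_norm_bounded ((hf.mul_left (5 * (h ^ 4)⁻¹))) (fun s => ?_)
    rw [Real.norm_eq_abs]
    refine ((hspan s).2.2).trans_eq ?_
    rw [epow s]; ring
  refine ⟨(summable_nat_add_iff s₀).1 hshift, ?_⟩
  -- (ii) the tail bound
  have hlow : ∀ s : ℕ, -(22 / 7 * (h ^ 4)⁻¹) * ((((s : ℝ) + s₀ + 1)) ^ 4)⁻¹ ≤ layerField a b (v (s + s₀)) := by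
    intro s
    refine le_of_eq_of_le ?_ (hspan s).2.1
    rw [epow s]; ring
  have h1 := Summable.tsum_le_tsum hlow (hf.mul_left _) hshift
  rw [tsum_mul_left] at h1
  have hprod : (h ^ 4)⁻¹ * ∑' i : ℕ, (((i : ℝ) + s₀ + 1) ^ 4)⁻¹ ≤ 4096 / 81 * (3 * (s₀ : ℝ) ^ 3)⁻¹ :=
    mul_le_mul hh4 hfle (tsum_nonneg fun _ => by positivity) (by norm_num)
  have hs3 : 0 < (3 * (s₀ : ℝ) ^ 3)⁻¹ := by positivity
  have e53 : (53 : ℝ) / (s₀ : ℝ) ^ 3 = 159 * (3 * (s₀ : ℝ) ^ 3)⁻¹ := by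
    field_simp; ring
  rw [e53]
  nlinarith

/-! ## §5 Cone XXXII — cut XXXI with TAIL discharged -/

/-- ★ cut XXXII (square branch extinct, boxed tube leaves, FINITE certificates, TAIL PROVED): beneath ★ `StackedCellPinningU` only
STR [ANALYTIC·M] and the two finite certificates FIN-T / FIN-S at level `e⋆ + 2κ' + 53/s₀³` remain; `s₁ s₂ h₀ κ' s₀` symbolic
(`0 < κ'`, `4 ≤ s₀`).  19 open leaves + 3 proved siblings (E1, ETB(e⋆), GEO) + TAIL proved. -/
theorem rdef_thirtysecond_of_recordK_finCert_ref (s₁ s₂ h₀ κ' : ℝ) (s₀ : ℕ) (hκ' : 0 < κ') (hs₀ : 4 ≤ s₀)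
    (hG : GrossCleanBallsU (1 / 250) 10)
    (hCEG : ChargedEnergyGap) (hC : CompressedVirialLaw (1 / 250) 10) (hS : TwoShellShape (1 / 100) (3 / 50) (1 / 450)) (hB₂ : BarlowGluingW)
    (hD : DoorPeriodicW 2) (hSR : StackedReductionW 2 (17 / 16)) (hV : GapStressVanishesW (17 / 16))
    (hP : RegistryPinningP (17 / 16) (1 / 40) (3 / 16) s₁ s₂ 1 0) (hT : TubeConvexRefP (17 / 16) (1 / 40) s₁ s₂ 1 0)
    (hSTR : StraightenedFloor (17 / 16))
    (hFT : StraightCellEnergyFinT (17 / 16) (3 / 8) (23 / 20) s₁ s₂ s₀ (eStar + 2 * κ' + 53 / (s₀ : ℝ) ^ 3))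
    (hFS : SquareCellsExtinctFin (17 / 16) (3 / 8) (23 / 20) s₀ (eStar + 2 * κ' + 53 / (s₀ : ℝ) ^ 3))
    (hGeo : RegistryGeometryW (17 / 16) s₁ s₂ h₀ (3 / 20))
    (hBal : BalancedLocus s₁ s₂ h₀ (1 / 40)) (hR1 : RegistryResidual s₁ s₂ (1 / 250)) (hR2 : RegistryTube s₁ s₂ (1 / 100) 1)
    (hMet : RegistryMetricCW s₁ s₂ (3 / 500)) (hCE : CleanlessExcessT) (hRes : CoherentResidual 10) : RobustDefectLimitWindows :=
  rdef_of_grossU_shape_gluing_pinningU_convexRefP_registry 2 (17 / 16) (1 / 40) (3 / 16) s₁ s₂ 1 0 (7 / 40) (3 / 500) 0 (1 / 100) (4 / 25) 0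
    (by norm_num) (by norm_num) le_rfl (by norm_num) hG hCEG hC hS hB₂ hD hSR hV hP hT
    (stackedCellPinningU_of_finCert hκ' le_rfl hSTR (layerFieldTailSum_holds s₀ hs₀) hFT hFS)
    (registryLocalisationW_of_geometry_locus (by norm_num) hGeo hBal)
    (zeroExists_of_residual_tube (by norm_num) (by norm_num) (by norm_num) (by norm_num) (by norm_num) (by norm_num) hR1 hR2) hMet
    (sqRegistryLocalisationW_of_geometry_height (by norm_num) (sqRegistryGeometryW_empty (17 / 16) 0 (3 / 20)) (sqBalancedHeight_empty 0 (1 / 100)))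
    (sqRegistryMetricCW_empty 0 (1 / 100) 0) hCE hRes

end Summit.AtomisticToContinuum.Crystallization.Theorems.OverbindingBudgetEnergyLayerTailSum

end
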